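import Literature.NumberTheory.LFunctions.GroupedPolyBoxCertificate
import HarnessLib

/-!
# Grouped box sign certificates with the inner `δ`-polynomial MERGED per power of `δ`

`GroupedPolyBoxCertificate.lean` evaluates the inner `δ, x`-polynomial of each group termwise:
every term `c · δ^a · x^f` gets its own `δ`-interval. When several terms share the same power
`a` (different `f`), the certificate point `x` is KNOWN, so `Σ_f c · x^f` is an exact rational and
only ONE interval multiplication by `[δ]^a` is needed; termwise evaluation instead adds up the
widths of terms of opposite sign. This file supplies the merged layout and checker — still
elementary interval arithmetic [Moore 1979, Thm. 3.1], same soundness statement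
[Szegő §3.3 (5)–(6)]:

* `MGPoly = List (List ℕ × List (ℕ × List (ℤ × ℕ)))` — groups `(e, [(a, [(c, f), …]), …])`
  meaning `(Π_k μ_k^{e_k}) · Σ_a δ^a · Σ (c · x^f)`; `mgpolyEvalR G (δ :: μ) x`;
* `mgpolyLower/mgpolyUpper` over a box `(δ-pair) :: μ-box`, inclusion theorem
  `mgpolyLower_le_and_le_mgpolyUpper`;
* `MGPolyCertifies G B d u` (decidable) and SOUNDNESS `splits_of_mgpolyCertifies`.

Why it matters (numbers, engine rh-explicit-jensen-eng-1 gen3, exact replay + kernel): the single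
"ladder" tail boxes `B_d(m, δ_d)` of the Jensen track (jensen-lead R-β4 (j)) are certified by the
merged evaluation for every `d ≤ 8` (kernel `decide`, 12–67 s per degree incl. the identity),
while the termwise grouped evaluation certifies only `d = 3, 4, 6`.

## References
* [Moore1979] R. E. Moore, *Methods and Applications of Interval Analysis*, SIAM 1979, Ch. 3,
  Thm. 3.1.
* [Szego1939] G. Szegő, *Orthogonal Polynomials*, §3.3 (5)–(6).
-/

open Polynomial Finset

namespace Literature.NumberTheory.LFunctions

/-- A merged grouped polynomial: list of `(outer exponents e, [(a, [(c, f), …]), …])`, value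
`Σ_groups (Π_k μ_k^{e_k}) · Σ_a δ^a · Σ c · x^f`. [cite: Moore1979, Ch. 3, Thm. 3.1] -/
abbrev MGPoly := List (List ℕ × List (ℕ × List (ℤ × ℕ)))

/-- Real value of an `x`-polynomial given as `[(c, f), …]`. [folklore] -/
noncomputable def xpolyEvalR (cs : List (ℤ × ℕ)) (x : ℝ) : ℝ :=
  (cs.map fun t => (t.1 : ℝ) * x ^ t.2).sum

/-- Exact rational value of an `x`-polynomial at a rational point. [folklore] -/
def xpolyEvalQ (cs : List (ℤ × ℕ)) (x : ℚ) : ℚ :=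
  (cs.map fun t => (t.1 : ℚ) * x ^ t.2).sum

/-- Real value of a merged inner `δ, x`-polynomial `Σ_a δ^a · q_a(x)`. [folklore] -/
noncomputable def minnerEvalR (ts : List (ℕ × List (ℤ × ℕ))) (δ x : ℝ) : ℝ :=
  (ts.map fun t => δ ^ t.1 * xpolyEvalR t.2 x).sum

/-- Real value of a merged grouped polynomial at `V = δ :: μ`. [folklore] -/
noncomputable def mgpolyEvalR (G : MGPoly) (V : List ℝ) (x : ℝ) : ℝ :=
  (G.map fun g => powProdR V.tail g.1 * minnerEvalR g.2 (V.headD 0) x).sum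

/-- Interval of the merged inner polynomial over the `δ`-pair at a rational `x`: one interval
product per power of `δ`, with the exact rational coefficient `q_a(x)`.
[cite: Moore1979, Ch. 3, Thm. 3.1] -/
def minnerIval (ts : List (ℕ × List (ℤ × ℕ))) (dI : ℚ × ℚ) (x : ℚ) : ℚ × ℚ :=
  ts.foldr (fun t acc =>
    let J := ipMul (xpolyEvalQ t.2 x, xpolyEvalQ t.2 x) (ipPow dI t.1)
    (J.1 + acc.1, J.2 + acc.2)) (0, 0)

/-- Interval of a merged grouped polynomial over the box `dI :: B` at a rational `x`.
[folklore] -/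
def mgpolyIval (G : MGPoly) (B : List (ℚ × ℚ)) (x : ℚ) : ℚ × ℚ :=
  G.foldr (fun g acc =>
    let J := ipMul (powProdI B.tail g.1) (minnerIval g.2 (B.headD (0, 0)) x)
    (J.1 + acc.1, J.2 + acc.2)) (0, 0)

/-- Lower bound of a merged grouped polynomial over a box. [folklore] -/
def mgpolyLower (G : MGPoly) (B : List (ℚ × ℚ)) (x : ℚ) : ℚ := (mgpolyIval G B x).1

/-- Upper bound of a merged grouped polynomial over a box. [folklore] -/
def mgpolyUpper (G : MGPoly) (B : List (ℚ × ℚ)) (x : ℚ) : ℚ := (mgpolyIval G B x).2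

/-- The exact rational evaluation casts to the real one. [folklore] -/
private theorem xpolyEvalQ_cast (cs : List (ℤ × ℕ)) (x : ℚ) :
    ((xpolyEvalQ cs x : ℚ) : ℝ) = xpolyEvalR cs (x : ℝ) := by
  induction cs with
  | nil => simp [xpolyEvalQ, xpolyEvalR]
  | cons t cs ih =>
    simp only [xpolyEvalQ, xpolyEvalR, List.map_cons, List.sum_cons, Rat.cast_add] at ih ⊢
    rw [ih]; push_cast; ring

/-- Inclusion for the merged inner polynomial. [cite: Moore1979, Ch. 3, Thm. 3.1] -/
theorem ipMem_minnerIval (ts : List (ℕ × List (ℤ × ℕ))) {dI : ℚ × ℚ} {δ : ℝ} (hδ : IPMem dI δ)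
    (x : ℚ) : IPMem (minnerIval ts dI x) (minnerEvalR ts δ (x : ℝ)) := by
  induction ts with
  | nil => simp [IPMem, minnerIval, minnerEvalR]
  | cons t ts ih =>
    have hs : IPMem (xpolyEvalQ t.2 x, xpolyEvalQ t.2 x) (xpolyEvalR t.2 (x : ℝ)) := by
      constructor <;> simp [xpolyEvalQ_cast]
    have ht := ipMem_ipMul hs (ipMem_ipPow hδ t.1)
    have hval : xpolyEvalR t.2 (x : ℝ) * δ ^ t.1 = δ ^ t.1 * xpolyEvalR t.2 (x : ℝ) := by ring
    rw [hval] at ht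
    simp only [minnerIval, List.foldr_cons, minnerEvalR, List.map_cons, List.sum_cons] at ih ⊢
    exact ⟨by push_cast; exact add_le_add ht.1 ih.1, by push_cast; exact add_le_add ht.2 ih.2⟩

/-- **Inclusion** for a merged grouped polynomial: `mgpolyLower ≤ G(V; x) ≤ mgpolyUpper` for `V`
in the box `B` (first coordinate = `δ`). [cite: Moore1979, Ch. 3, Thm. 3.1] -/
theorem mgpolyLower_le_and_le_mgpolyUpper (G : MGPoly) {B : List (ℚ × ℚ)} {V : List ℝ}
    (h : BoxMem B V) (x : ℚ) :
    ((mgpolyLower G B x : ℚ) : ℝ) ≤ mgpolyEvalR G V (x : ℝ) ∧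
      mgpolyEvalR G V (x : ℝ) ≤ ((mgpolyUpper G B x : ℚ) : ℝ) := by
  have hhead : IPMem (B.headD (0, 0)) (V.headD 0) := by
    cases h with
    | nil => simp [IPMem]
    | cons hb _ => exact hb
  have htail : BoxMem B.tail V.tail := by
    cases h with
    | nil => exact List.Forall₂.nil
    | cons _ ht => exact ht
  unfold mgpolyLower mgpolyUpper
  induction G with
  | nil => simp [mgpolyIval, mgpolyEvalR]
  | cons g G ih =>
    have hg := ipMem_ipMul (ipMem_powProd htail g.1) (ipMem_minnerIval g.2 hhead x)
    simp only [mgpolyIval, List.foldr_cons, mgpolyEvalR, List.map_cons, List.sum_cons] at ih ⊢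
    exact ⟨by push_cast; exact add_le_add hg.1 ih.1, by push_cast; exact add_le_add hg.2 ih.2⟩

/-- Certified sign of a merged grouped polynomial over the box. [folklore] -/
def mgpolySignAt (G : MGPoly) (B : List (ℚ × ℚ)) (x : ℚ) : ℤ :=
  if 0 < mgpolyLower G B x then 1 else if mgpolyUpper G B x < 0 then -1 else 0

/-- **Merged grouped box sign certificate** (decidable). [cite: Szego1939, §3.3 (5)–(6)] -/
def MGPolyCertifies (G : MGPoly) (B : List (ℚ × ℚ)) (d : ℕ) (u : Fin (d + 1) → ℚ) : Prop :=
  (∀ i : Fin d, u i.castSucc < u i.succ) ∧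
    ∀ i : Fin d, mgpolySignAt G B (u i.castSucc) * mgpolySignAt G B (u i.succ) = -1

/-- `MGPolyCertifies` is decidable. [folklore] -/
instance (G : MGPoly) (B : List (ℚ × ℚ)) (d : ℕ) (u : Fin (d + 1) → ℚ) :
    Decidable (MGPolyCertifies G B d u) := by
  unfold MGPolyCertifies; infer_instance

section Soundness

variable {G : MGPoly} {B : List (ℚ × ℚ)} {V : List ℝ} {Q : ℝ[X]} {c : ℝ}

/-- Opposite certified signs give a sign change. [folklore] -/
private theorem eval_mul_eval_neg_of_mgpolySignAt (h : BoxMem B V) (hc : 0 < c)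
    (hQ : ∀ x : ℚ, c * Q.eval (x : ℝ) = mgpolyEvalR G V x) {x y : ℚ}
    (hs : mgpolySignAt G B x * mgpolySignAt G B y = -1) :
    Q.eval (x : ℝ) * Q.eval (y : ℝ) < 0 := by
  have pos : ∀ {z : ℚ}, mgpolySignAt G B z = 1 → 0 < Q.eval (z : ℝ) := by
    intro z hz
    have h1 : 0 < mgpolyLower G B z := by
      by_contra hc'
      unfold mgpolySignAt at hz
      rw [if_neg hc'] at hz
      by_cases h2 : mgpolyUpper G B z < 0
      · rw [if_pos h2] at hz; omega
      · rw [if_neg h2] at hz; omega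
    have := (mgpolyLower_le_and_le_mgpolyUpper G h z).1
    have hcz : 0 < c * Q.eval (z : ℝ) := by
      rw [hQ]; exact lt_of_lt_of_le (by exact_mod_cast h1) this
    exact pos_of_mul_pos_right hcz hc.le
  have neg : ∀ {z : ℚ}, mgpolySignAt G B z = -1 → Q.eval (z : ℝ) < 0 := by
    intro z hz
    have h2 : mgpolyUpper G B z < 0 := by
      by_contra hc'
      unfold mgpolySignAt at hz
      by_cases h1 : 0 < mgpolyLower G B z
      · rw [if_pos h1] at hz; omega
      · rw [if_neg h1, if_neg hc'] at hz; omega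
    have := (mgpolyLower_le_and_le_mgpolyUpper G h z).2
    have hcz : c * Q.eval (z : ℝ) < 0 := by
      rw [hQ]; exact lt_of_le_of_lt this (by exact_mod_cast h2)
    exact neg_of_mul_neg_right hcz hc.le
  have hx : mgpolySignAt G B x = 1 ∨ mgpolySignAt G B x = -1 ∨ mgpolySignAt G B x = 0 := by
    unfold mgpolySignAt; split_ifs <;> simp
  have hy : mgpolySignAt G B y = 1 ∨ mgpolySignAt G B y = -1 ∨ mgpolySignAt G B y = 0 := by
    unfold mgpolySignAt; split_ifs <;> simp
  rcases hx with hx | hx | hx <;> rcases hy with hy | hy | hy <;> rw [hx, hy] at hs <;>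
    norm_num at hs
  · exact mul_neg_of_pos_of_neg (pos hx) (neg hy)
  · exact mul_neg_of_neg_of_pos (neg hx) (pos hy)

/-- **Soundness of the merged grouped box sign certificate.** [cite: Szego1939, §3.3 (5)–(6)] -/
theorem splits_of_mgpolyCertifies {d : ℕ} {u : Fin (d + 1) → ℚ}
    (hcert : MGPolyCertifies G B d u) (h : BoxMem B V) (hc : 0 < c) (hdeg : Q.natDegree ≤ d)
    (hQ : ∀ x : ℚ, c * Q.eval (x : ℝ) = mgpolyEvalR G V x) : Q.Splits := by
  obtain ⟨hmono, halt⟩ := hcert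
  rcases Nat.eq_zero_or_pos d with rfl | hd
  · rw [eq_C_of_natDegree_le_zero hdeg]; exact Splits.C _
  · have hu : StrictMono (fun i : Fin (d + 1) => ((u i : ℚ) : ℝ)) :=
      Fin.strictMono_iff_lt_succ.2 fun i => by exact_mod_cast hmono i
    have halt' : ∀ i : Fin d,
        Q.eval (((u i.castSucc : ℚ)) : ℝ) * Q.eval (((u i.succ : ℚ)) : ℝ) < 0 :=
      fun i => eval_mul_eval_neg_of_mgpolySignAt h hc hQ (halt i)
    obtain ⟨t, ht, -, hroot⟩ :=
      exists_roots_of_alternating Q (fun i : Fin (d + 1) => ((u i : ℚ) : ℝ)) hu halt'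
    have hQ0 : Q ≠ 0 := by
      intro h0
      have := halt' ⟨0, hd⟩
      rw [h0] at this
      simp at this
    exact (splits_of_roots hQ0 hdeg t ht.injective hroot).1

end Soundness

end Literature.NumberTheory.LFunctions
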